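/-
Origin: expansion seat `planner-pub-hodgecm-mc-axioms-1-g14-0`, handover #W174 2026-08-20T15:53:55Z md5 01df27c70d48 (PKG 8223f6fb2ee0 → 01df27c70d48; 306 l.; MECHANICAL (iib-R) rewrite v3.1 of the PKG file as it stands (49 token edits; rules R1x1+RX[h₂]x48)) (`HOME/mc/pub-hodgecm-mc-axioms-1-g14/revendor/kit-r55/stage55/HodgeCM/Model/HypCensus/KappaJoin.lean`, md5 01df27c70d48, 306 lines);
landed by the gen-22 packager (p-g22) in gate run 55 REPLACES the earlier landed copy of `HodgeCM/Model/HypCensus/KappaJoin.lean` (seat copy carried the packager Origin header of an earlier run (stripped)).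
-/
/-
Copyright (c) 2026. All rights reserved.
Released under Apache 2.0 license as described in the file LICENSE.
-/
import Summits.HodgeConjecture.HodgeCM.Model.HypCensus.HypOfCensusType
import Summits.HodgeConjecture.HodgeCM.Model.ArchKTypeOfSigmaIotaVal
import Summits.HodgeConjecture.HodgeCM.Model.ArchKTypeOfLineR1Family

/-!
# The (V-val) JOIN at the R1 pin: the pair's vacuum exponents at `v₁` are the lines' plus the see-saw exponent; rows 18/19 at `χV := χVR`

Two kernel routes now give the pin's letter character on the `ι₁`-letters `(A, D) ∈ U(V⁺_{v₁}) × U(V⁻_{v₁})`: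
binder-2 #75 `pinLetterChar_kVLetters_mulSingle_cmPlace_eq_det_zpow` — `det A^{e_P} · det D^{e_Q}` with the PAIR's exponents of record at `v₁`
(`iotaVacExponents`, from the pair's own small Weil datum) — and carch-1 #CA38 `pinLetterChar_kVLetters_mulSingle_cmPlace` —
`tw(det A·det D)^ℓ · det A^{e_P⁰} det D^{e_Q⁰} · det A^{e_P¹} det D^{e_Q¹}` from the see-saw of the two LINE vacua (`lineVacExponentsZero/One`,
`lambdaExponent`).  This leaf equates them:

* §1 **`iotaVacExponents_eP_eq`** / **`iotaVacExponents_eQ_eq`**: `e_P = e_P⁰ + e_P¹ + ℓ`, `e_Q = e_Q⁰ + e_Q¹ + ℓ` (canonical representative; test letters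
  `diag(z, 1)` / `z` and `int_eq_zero_of_forall_norm_one_zpow_eq_one`) — the see-saw exponent identity AT `v₁`, the twin of carch-1 #CA36
  `pairVacExponent_eq` off `v₁`;
* §2 **`pairType_eq_nVR`**: binder-2's W-side type of `χ_V` (#76 `pairType`) IS carch-1's read-off table `nVR` (#CA33) — as functions on the
  infinite places of `L`; hence at the pin **`hasArchType_χVR_pairType`**: the CONSTRUCTED `χVR` (#CA35) has the W-side type;
* §3 **`hyp12_of_census_R1At`** / **`hyp34_of_census_R1At`**: E's binders `hyp12`/`hyp34` AT ONE GOOD CANONICAL CONTEXT for the W family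
  `Wcm hGR (EtaChi.η χVR χW) …` (any `χW` family), from the context datum `jD` and the (J-T) junction `homg`/`homg₃₄` ALONE — (V-val) is no longer a
  hypothesis of rows 18/19 at the R1 pin (#77 `hyp12_of_census_of_typeAt` + §2; equivalently #77's socket `hyp12_of_census_of_hκAt` + carch-1 `hκ_R1`).

RESIDUAL of rows 18/19 at the R1 pin after this leaf: {`homg`/`homg₃₄` ((J-T12)/(J-T34) `∀ φ` junctions; (T12) desk)} + data `jD`.
Nothing here is a claim of PerL/QW8.

**(T12)/(B1′) second table.** RULING S5b (B1′) re-base: §3 `hyp12_of_census_R1At` / `hyp34_of_census_R1At` carry the torus twist `{σ}` (implicit, right after `jD`; the junction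
hypothesis is spelled over `printedAtσ … σ` / `datumAtσ … σ`); `σ = 1` = the statements of record (glue-1's consumers elaborate unchanged), `σ = sigma34 c.D`
is the (34) census consumed by N5 `KappaJoinMu`.
-/

set_option autoImplicit false

noncomputable section

open scoped TensorProduct InnerProductSpace Matrix Topology Classical
open Filter
open NumberField NumberField.InfinitePlace

namespace HodgeCM.Model.HypCensus

open HodgeCM HodgeCM.Model HodgeCM.Universe HodgeCM.Adelic
open HodgeCM.Universe (AdelicThetaCore AdelicThetaCore₀ SideData ThetaModel)
open HodgeCM.PerL34 HodgeCM.PerL34.ArchC HodgeCM.PerL34.Fock HodgeCM.PerL34.Fock.PrintDict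
open HodgeCM.Model.ArchSideTerm (e₁ posIdxEquivUnit negIdxEquivEmpty lambdaExponent)
open Literature.AlgebraicGeometry.HodgeTheory
open Literature.NumberTheory.Automorphic.PicardCM
open Literature.NumberTheory.Transcendental (Arapura2012_Cor_15_4_6)
open Literature.NumberTheory.Automorphic (piSchwartzBruhat FinSB)
open Literature.NumberTheory.Automorphic.UnitaryGroup
open Literature.NumberTheory.Weil1964 (repWeilThetaDatum PosIdx NegIdx)
open Literature.NumberTheory.GelbartRogawski1991 Literature.NumberTheory.GelbartRogawski1991.UnitaryDualPair
open Literature.RepresentationTheory.CompactGroups (UnitaryGroupChar.diagU UnitaryGroupChar.coe_diagU)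
open NumberField.SeesawArchTorus

/-! ## §1 The see-saw exponent identity at `v₁` -/

section Join

variable {L : CMField} {ι₁ : L →+* ℂ} (V : HermSpace3 L ι₁) (c : SeesawCtx L)
variable
  (hGR : (cmSplittingDatum (L : Type) finProdFinEquiv (frameD V) (frameD_real V) (frameD_ne V) (dW c.D) (dW_real c.D) (dW_ne c.D)).CompatibleSplitting)
  (hGR₀ : (cmSplittingDatum (L : Type) (e₁) (frameD V) (frameD_real V) (frameD_ne V) (lineVec (L : Type) (dW c.D 0))
    (fun _ => dW_real c.D 0) (fun _ => dW_ne c.D 0)).CompatibleSplitting)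
  (hGR₁ : (cmSplittingDatum (L : Type) (e₁) (frameD V) (frameD_real V) (frameD_ne V) (lineVec (L : Type) (dW c.D 1))
    (fun _ => dW_real c.D 1) (fun _ => dW_ne c.D 1)).CompatibleSplitting)
  (h₁W : (∀ j, 0 < (ι₁ (dW c.D j)).re) ∨ ∀ j, (ι₁ (dW c.D j)).re < 0)
  (hpos₀ : 0 < cmXW (L : Type) (frameD V) (lineVec (L : Type) (dW c.D 0)) (fun _ => dW_real c.D 0) ι₁ (cmPlace (L : Type) ι₁) 0)
  (hpos₁ : 0 < cmXW (L : Type) (frameD V) (lineVec (L : Type) (dW c.D 1)) (fun _ => dW_real c.D 1) ι₁ (cmPlace (L : Type) ι₁) 0)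
  (hemb : (InfinitePlace.mk ι₁).embedding = ι₁)

include hpos₀ hpos₁ in
/-- the two lines' positivity at `v₁` IS the pair's positive `W`-reading there. -/
theorem hposW_of_lines : ∀ j, 0 < cmXW (L : Type) (frameD V) (dW c.D) (dW_real c.D) ι₁ (cmPlace (L : Type) ι₁) j := fun j => by
  fin_cases j
  · exact hpos₀
  · exact hpos₁

/-- a `V⁺_{v₁}`-letter of prescribed determinant `z`, `‖z‖ = 1`: `diag(z, 1, …)`. -/
theorem exists_posLetter_det_eq (z : ℂ) (hz : ‖z‖ = 1) :
    ∃ A : Matrix.unitaryGroup (PosIdx (cmXV (L : Type) (frameD V) (frameD_real V) ι₁ (cmPlace (L : Type) ι₁))) ℂ,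
      (A : Matrix (PosIdx (cmXV (L : Type) (frameD V) (frameD_real V) ι₁ (cmPlace (L : Type) ι₁)))
        (PosIdx (cmXV (L : Type) (frameD V) (frameD_real V) ι₁ (cmPlace (L : Type) ι₁))) ℂ).det = z := by
  refine ⟨UnitaryGroupChar.diagU (Function.update (fun _ => (1 : Circle)) ((blockPosEquiv V).symm 0) (circleOfNorm z hz)), ?_⟩
  rw [UnitaryGroupChar.coe_diagU, Matrix.det_diagonal]
  refine (map_prod Circle.coeHom _ Finset.univ).symm.trans ?_
  rw [Finset.prod_update_of_mem (Finset.mem_univ _), Finset.prod_const_one, mul_one]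
  rfl

/-- a `V⁻_{v₁}`-letter of prescribed determinant `z`, `‖z‖ = 1`. -/
theorem exists_negLetter_det_eq (z : ℂ) (hz : ‖z‖ = 1) :
    ∃ D : Matrix.unitaryGroup (NegIdx (cmXV (L : Type) (frameD V) (frameD_real V) ι₁ (cmPlace (L : Type) ι₁))) ℂ,
      (D : Matrix (NegIdx (cmXV (L : Type) (frameD V) (frameD_real V) ι₁ (cmPlace (L : Type) ι₁)))
        (NegIdx (cmXV (L : Type) (frameD V) (frameD_real V) ι₁ (cmPlace (L : Type) ι₁))) ℂ).det = z := by
  refine ⟨UnitaryGroupChar.diagU (Function.update (fun _ => (1 : Circle)) (iotaNegPt V) (circleOfNorm z hz)), ?_⟩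
  rw [UnitaryGroupChar.coe_diagU, Matrix.det_diagonal]
  refine (map_prod Circle.coeHom _ Finset.univ).symm.trans ?_
  rw [Finset.prod_update_of_mem (Finset.mem_univ _), Finset.prod_const_one, mul_one]
  rfl

include hemb hGR₀ hGR₁ hpos₀ hpos₁ in
/-- the two closed forms on a letter `(A, D)`, equated (canonical representative: `tw = id`). -/
theorem det_zpow_pair_eq_det_zpow_lines
    (x : Matrix.unitaryGroup (PosIdx (cmXV (L : Type) (frameD V) (frameD_real V) ι₁ (cmPlace (L : Type) ι₁))) ℂ ×
      Matrix.unitaryGroup (NegIdx (cmXV (L : Type) (frameD V) (frameD_real V) ι₁ (cmPlace (L : Type) ι₁))) ℂ) :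
    (x.1 : Matrix (PosIdx (cmXV (L : Type) (frameD V) (frameD_real V) ι₁ (cmPlace (L : Type) ι₁)))
          (PosIdx (cmXV (L : Type) (frameD V) (frameD_real V) ι₁ (cmPlace (L : Type) ι₁))) ℂ).det ^
          (iotaVacExponents V c.D hGR h₁W (hposW_of_lines V c hpos₀ hpos₁)).eP *
        (x.2 : Matrix (NegIdx (cmXV (L : Type) (frameD V) (frameD_real V) ι₁ (cmPlace (L : Type) ι₁)))
          (NegIdx (cmXV (L : Type) (frameD V) (frameD_real V) ι₁ (cmPlace (L : Type) ι₁))) ℂ).det ^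
          (iotaVacExponents V c.D hGR h₁W (hposW_of_lines V c hpos₀ hpos₁)).eQ =
      ((x.1 : Matrix (PosIdx (cmXV (L : Type) (frameD V) (frameD_real V) ι₁ (cmPlace (L : Type) ι₁)))
            (PosIdx (cmXV (L : Type) (frameD V) (frameD_real V) ι₁ (cmPlace (L : Type) ι₁))) ℂ).det *
          (x.2 : Matrix (NegIdx (cmXV (L : Type) (frameD V) (frameD_real V) ι₁ (cmPlace (L : Type) ι₁)))
            (NegIdx (cmXV (L : Type) (frameD V) (frameD_real V) ι₁ (cmPlace (L : Type) ι₁))) ℂ).det) ^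
          lambdaExponent V c.D hGR hGR₀ hGR₁ h₁W *
        ((x.1 : Matrix (PosIdx (cmXV (L : Type) (frameD V) (frameD_real V) ι₁ (cmPlace (L : Type) ι₁)))
            (PosIdx (cmXV (L : Type) (frameD V) (frameD_real V) ι₁ (cmPlace (L : Type) ι₁))) ℂ).det ^
            (lineVacExponentsZero V c hGR₀ h₁W (posIdxEquivUnit hpos₀) (negIdxEquivEmpty hpos₀)).eP *
          (x.2 : Matrix (NegIdx (cmXV (L : Type) (frameD V) (frameD_real V) ι₁ (cmPlace (L : Type) ι₁)))
            (NegIdx (cmXV (L : Type) (frameD V) (frameD_real V) ι₁ (cmPlace (L : Type) ι₁))) ℂ).det ^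
            (lineVacExponentsZero V c hGR₀ h₁W (posIdxEquivUnit hpos₀) (negIdxEquivEmpty hpos₀)).eQ) *
        ((x.1 : Matrix (PosIdx (cmXV (L : Type) (frameD V) (frameD_real V) ι₁ (cmPlace (L : Type) ι₁)))
            (PosIdx (cmXV (L : Type) (frameD V) (frameD_real V) ι₁ (cmPlace (L : Type) ι₁))) ℂ).det ^
            (lineVacExponentsOne V c hGR₁ h₁W (posIdxEquivUnit hpos₁) (negIdxEquivEmpty hpos₁)).eP *
          (x.2 : Matrix (NegIdx (cmXV (L : Type) (frameD V) (frameD_real V) ι₁ (cmPlace (L : Type) ι₁)))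
            (NegIdx (cmXV (L : Type) (frameD V) (frameD_real V) ι₁ (cmPlace (L : Type) ι₁))) ℂ).det ^
            (lineVacExponentsOne V c hGR₁ h₁W (posIdxEquivUnit hpos₁) (negIdxEquivEmpty hpos₁)).eQ) := by
  have h := HodgeCM.Model.pinLetterChar_kVLetters_mulSingle_cmPlace V c hGR hGR₀ hGR₁ h₁W hpos₀ hpos₁ x
  rw [pinLetterChar_kVLetters_mulSingle_cmPlace_eq_det_zpow V c.D hGR h₁W (hposW_of_lines V c hpos₀ hpos₁),
    embTwist_apply_of_eq (L : Type) ι₁ hemb] at h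
  exact h

include hemb hGR₀ hGR₁ hpos₀ hpos₁ in
/-- **THE SEE-SAW EXPONENT IDENTITY AT `v₁`, `V⁺` part**: `e_P(pair) = e_P⁰ + e_P¹ + ℓ`. -/
theorem iotaVacExponents_eP_eq :
    (iotaVacExponents V c.D hGR h₁W (hposW_of_lines V c hpos₀ hpos₁)).eP =
      (lineVacExponentsZero V c hGR₀ h₁W (posIdxEquivUnit hpos₀) (negIdxEquivEmpty hpos₀)).eP +
        (lineVacExponentsOne V c hGR₁ h₁W (posIdxEquivUnit hpos₁) (negIdxEquivEmpty hpos₁)).eP + lambdaExponent V c.D hGR hGR₀ hGR₁ h₁W := by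
  refine eq_of_sub_eq_zero (int_eq_zero_of_forall_norm_one_zpow_eq_one _ fun z hz => ?_)
  have hz0 : z ≠ 0 := norm_ne_zero_iff.mp (by rw [hz]; exact one_ne_zero)
  obtain ⟨A, hA⟩ := exists_posLetter_det_eq V z hz
  have h := det_zpow_pair_eq_det_zpow_lines V c hGR hGR₀ hGR₁ h₁W hpos₀ hpos₁ hemb (A, 1)
  simp only [OneMemClass.coe_one, Matrix.det_one, one_zpow, mul_one, hA] at h
  rw [← zpow_add₀ hz0, ← zpow_add₀ hz0] at h
  rw [zpow_sub₀ hz0, h, ← zpow_sub₀ hz0, show _ - _ = (0 : ℤ) by ring, zpow_zero]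

include hemb hGR₀ hGR₁ hpos₀ hpos₁ in
/-- **THE SEE-SAW EXPONENT IDENTITY AT `v₁`, `V⁻` part**: `e_Q(pair) = e_Q⁰ + e_Q¹ + ℓ`. -/
theorem iotaVacExponents_eQ_eq :
    (iotaVacExponents V c.D hGR h₁W (hposW_of_lines V c hpos₀ hpos₁)).eQ =
      (lineVacExponentsZero V c hGR₀ h₁W (posIdxEquivUnit hpos₀) (negIdxEquivEmpty hpos₀)).eQ +
        (lineVacExponentsOne V c hGR₁ h₁W (posIdxEquivUnit hpos₁) (negIdxEquivEmpty hpos₁)).eQ + lambdaExponent V c.D hGR hGR₀ hGR₁ h₁W := by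
  refine eq_of_sub_eq_zero (int_eq_zero_of_forall_norm_one_zpow_eq_one _ fun z hz => ?_)
  have hz0 : z ≠ 0 := norm_ne_zero_iff.mp (by rw [hz]; exact one_ne_zero)
  obtain ⟨D, hD⟩ := exists_negLetter_det_eq V z hz
  have h := det_zpow_pair_eq_det_zpow_lines V c hGR hGR₀ hGR₁ h₁W hpos₀ hpos₁ hemb (1, D)
  simp only [OneMemClass.coe_one, Matrix.det_one, one_zpow, one_mul, hD] at h
  rw [← zpow_add₀ hz0, ← zpow_add₀ hz0] at h
  rw [zpow_sub₀ hz0, h, ← zpow_sub₀ hz0, show _ - _ = (0 : ℤ) by ring, zpow_zero]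

/-! ## §2 binder-2's W-side type IS carch-1's read-off table -/

include hemb hGR₀ hGR₁ hpos₀ hpos₁ in
/-- **`pairType = nVR`** (as functions on the infinite places of `L`). -/
theorem pairType_eq_nVR :
    pairType V c.D hGR h₁W (hposW_of_lines V c hpos₀ hpos₁) = nVR V c hGR hGR₀ hGR₁ h₁W hpos₀ hpos₁ := by
  funext w
  rw [← cmPlaceOver_placeUnder w]
  by_cases hb : placeUnder w = cmPlace (L : Type) ι₁
  · rw [hb, pairType_cmPlaceOver_cmPlace, nVR_cmPlaceOver_cmPlace V c hGR hGR₀ hGR₁ h₁W hpos₀ hpos₁,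
      iotaVacExponents_eP_eq V c hGR hGR₀ hGR₁ h₁W hpos₀ hpos₁ hemb]
    ring
  · rw [pairType_cmPlaceOver_of_ne V c.D hGR h₁W _ _ hb, nVR_eq_neg_pairVacExponent V c hGR hGR₀ hGR₁ h₁W hpos₀ hpos₁ hb]

/-- `pairType` does not depend on the proofs it is indexed by (restatement for rewriting under other proof terms). -/
theorem pairType_congr (hW hW' : (∀ j, 0 < (ι₁ ((dW c.D) j)).re) ∨ ∀ j, (ι₁ ((dW c.D) j)).re < 0)
    (hpos hpos' : ∀ j, 0 < cmXW (L : Type) (frameD V) (dW c.D) (dW_real c.D) ι₁ (cmPlace (L : Type) ι₁) j) :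
    pairType V c.D hGR hW hpos = pairType V c.D hGR hW' hpos' := rfl

end Join

/-! ## §2b At the pin: the constructed `χVR` has the W-side type -/

section Pin

variable
  (hGR : ∀ {L : CMField} {ι₁ : L →+* ℂ} (V : HermSpace3 L ι₁) (c : SeesawCtx L),
    (cmSplittingDatum (L : Type) finProdFinEquiv (frameD V) (frameD_real V) (frameD_ne V) (dW c.D) (dW_real c.D) (dW_ne c.D)).CompatibleSplitting)
  (hGR₀ : ∀ {L : CMField} {ι₁ : L →+* ℂ} (V : HermSpace3 L ι₁) (c : SeesawCtx L),
    (cmSplittingDatum (L : Type) (e₁) (frameD V) (frameD_real V) (frameD_ne V) (lineVec (L : Type) (dW c.D 0))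
      (fun _ => dW_real c.D 0) (fun _ => dW_ne c.D 0)).CompatibleSplitting)
  (hGR₁ : ∀ {L : CMField} {ι₁ : L →+* ℂ} (V : HermSpace3 L ι₁) (c : SeesawCtx L),
    (cmSplittingDatum (L : Type) (e₁) (frameD V) (frameD_real V) (frameD_ne V) (lineVec (L : Type) (dW c.D 1))
      (fun _ => dW_real c.D 1) (fun _ => dW_ne c.D 1)).CompatibleSplitting)

/-- **the CONSTRUCTED `χ_V` of the R1 pin (`SInstance.χVR`, #CA35) HAS binder-2's W-side archimedean type `pairType`** at every good canonical
context (for whichever proofs `hW`, `hpos` the type is indexed by). -/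
theorem hasArchType_χVR_pairType {L : CMField} {ι₁ : L →+* ℂ} (V : HermSpace3 L ι₁) (c : SeesawCtx L) (hG : SInstance.GOG V c)
    (hW : (∀ j, 0 < (ι₁ ((dW c.D) j)).re) ∨ ∀ j, (ι₁ ((dW c.D) j)).re < 0)
    (hpos : ∀ j, 0 < cmXW (L : Type) (frameD V) (dW c.D) (dW_real c.D) ι₁ (cmPlace (L : Type) ι₁) j) :
    Literature.NumberTheory.Automorphic.UnitaryLineChar.HasArchType (L : Type) (SInstance.χVR @hGR @hGR₀ @hGR₁ V c)
      (pairType V c.D (hGR V c) hW hpos) := by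
  rw [pairType_congr V c (hGR V c) hW (SInstance.hG_GOG V c hG) hpos
      (hposW_of_lines V c (SInstance.hpos_GOG V c hG).1 (SInstance.hpos_GOG V c hG).2.1),
    pairType_eq_nVR V c (hGR V c) (hGR₀ V c) (hGR₁ V c) (SInstance.hG_GOG V c hG) (SInstance.hpos_GOG V c hG).1
      (SInstance.hpos_GOG V c hG).2.1 hG.1]
  exact SInstance.hasArchType_χVR_of_GOG @hGR @hGR₀ @hGR₁ V c hG

end Pin

/-! ## §3 Rows 18/19 at the R1 pin: (V-val) is no longer a hypothesis -/

section R1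

variable (hHD : exists_isReal_hodgeModel) (hI : hodgePQ_independent_of_hodgeModel)
  (h₁ : BallQuotientUniformised)  (h₃ : CMAbelianVarietyRealised)
variable (hA : Arapura2012_Cor_15_4_6)
variable
  (hGR : ∀ {L : CMField} {ι₁ : L →+* ℂ} (V : HermSpace3 L ι₁) (c : SeesawCtx L),
    (cmSplittingDatum (L : Type) finProdFinEquiv (frameD V) (frameD_real V) (frameD_ne V) (dW c.D) (dW_real c.D) (dW_ne c.D)).CompatibleSplitting)
  (hGR₀ : ∀ {L : CMField} {ι₁ : L →+* ℂ} (V : HermSpace3 L ι₁) (c : SeesawCtx L),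
    (cmSplittingDatum (L : Type) (e₁) (frameD V) (frameD_real V) (frameD_ne V) (lineVec (L : Type) (dW c.D 0))
      (fun _ => dW_real c.D 0) (fun _ => dW_ne c.D 0)).CompatibleSplitting)
  (hGR₁ : ∀ {L : CMField} {ι₁ : L →+* ℂ} (V : HermSpace3 L ι₁) (c : SeesawCtx L),
    (cmSplittingDatum (L : Type) (e₁) (frameD V) (frameD_real V) (frameD_ne V) (lineVec (L : Type) (dW c.D 1))
      (fun _ => dW_real c.D 1) (fun _ => dW_ne c.D 1)).CompatibleSplitting)
  (χW : ∀ {L : CMField} {ι₁ : L →+* ℂ} (_V : HermSpace3 L ι₁) (_c : SeesawCtx L),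
    ContinuousMonoidHom (Literature.NumberTheory.Automorphic.relNormOneIdeles (maximalRealSubfield (L : Type)) (L : Type) ⧸
      Literature.NumberTheory.Automorphic.relNormOneRat (maximalRealSubfield (L : Type)) (L : Type)) Circle)
  (S : ∀ {L : CMField} {ι₁ : L →+* ℂ} (V : HermSpace3 L ι₁) (c : SeesawCtx L), ThetaAdelicSide V c)
  (μ : ∀ {L : CMField}, SeesawCtx L → Fin 4 → InfinitePlace L → ℤ)
variable {L : CMField} {ι₁ : L →+* ℂ} (V : HermSpace3 L ι₁) (c : SeesawCtx L)

/-- **E's binder `hyp12` (row 18) AT ONE GOOD CANONICAL CONTEXT for the W family at the R1 pin's CONSTRUCTED `χV := SInstance.χVR`, modulo the (J-T) junction `homg` ONLY** ((V-val) discharged by `hasArchType_χVR_pairType`; (J-dense) by #70). -/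
theorem hyp12_of_census_R1At
    (hc : (thetaModelOf hHD hI h₁ h₃ (orientBitι L ι₁) (_root_.HodgeCM.Model.embOf hHD hI h₁ h₃) (coverOf hHD hI h₁ h₃ hA) (wmOfInput (Wcm hGR (EtaChi.η (@SInstance.χVR @hGR @hGR₀ @hGR₁) @χW) (EtaChi.hη (@SInstance.χVR @hGR @hGR₀ @hGR₁) @χW) (EtaChi.hηc (@SInstance.χVR @hGR @hGR₀ @hGR₁) @χW))) (thetaOf _ (thetaClassInputOf _ (fun V c => thetaSpaceInputOf hHD hI h₁ h₃ S V c))) (d12Of μ) (d34Of μ)).GoodCtx ι₁ c)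
    (hK : Module.finrank ℚ c.K = 6) (hcan : (InfinitePlace.mk ι₁).embedding = ι₁)
    (jD : InfinitePlace (L : Type) → EqVar → Fin 6) {σ : InfinitePlace (L : Type) → Equiv.Perm (Fin 2)}
    (homg : ∀ (hW : (∀ j, 0 < (ι₁ ((dW c.D) j)).re) ∨ ∀ j, (ι₁ ((dW c.D) j)).re < 0) (f : FinSB ↥(maximalRealSubfield L) (Fin 6))
      (t : (printedAtσ V c.D hW jD (fun w => -μ c 0 w) (fun w => -μ c 1 w) σ).Tg)
      (φ : (printedAtσ V c.D hW jD (fun w => -μ c 0 w) (fun w => -μ c 1 w) σ).F),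
      omgW (Wcm hGR (EtaChi.η (@SInstance.χVR @hGR @hGR₀ @hGR₁) @χW) (EtaChi.hη (@SInstance.χVR @hGR @hGR₀ @hGR₁) @χW) (EtaChi.hηc (@SInstance.χVR @hGR @hGR₀ @hGR₁) @χW) V c)
          (printedTorusHom (kindOf (L : Type) (frameD V) (frameD_real V) (dW c.D) (dW_real c.D) ι₁ (datumAtσ V c.D jD (jIOf V c.D hW) σ))
            (lamOf (L : Type) (frameD V) (frameD_real V) (dW c.D) (dW_real c.D) ι₁ (datumAtσ V c.D jD (jIOf V c.D hW) σ))
            (lamOf_ne_zero (L : Type) (frameD V) (frameD_real V) (dW c.D) (dW_real c.D) ι₁ (datumAtσ V c.D jD (jIOf V c.D hW) σ))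
            (c.D.jT₁₂.toMonoidHom.comp (toAdeles (L : Type)))
            (pinnedVacs (kindOf (L : Type) (frameD V) (frameD_real V) (dW c.D) (dW_real c.D) ι₁ (datumAtσ V c.D jD (jIOf V c.D hW) σ))
              (fun w => -μ c 0 w) (fun w => -μ c 1 w)) t)
          (ins (L : Type) (frameD V) (frameD_real V) (frameD_ne V) (dW c.D) (dW_real c.D) (dW_ne c.D) ι₁ (datumAtσ V c.D jD (jIOf V c.D hW) σ)
            (fun w => -μ c 0 w) (fun w => -μ c 1 w) f φ) =
        ins (L : Type) (frameD V) (frameD_real V) (frameD_ne V) (dW c.D) (dW_real c.D) (dW_ne c.D) ι₁ (datumAtσ V c.D jD (jIOf V c.D hW) σ)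
          (fun w => -μ c 0 w) (fun w => -μ c 1 w) f
          ((printedAtσ V c.D hW jD (fun w => -μ c 0 w) (fun w => -μ c 1 w) σ).ωT t φ)) :
    Nonempty (((coreOf _ (_root_.HodgeCM.Model.embOf hHD hI h₁ h₃) (coverOf hHD hI h₁ h₃ hA) (wmOfInput (Wcm hGR (EtaChi.η (@SInstance.χVR @hGR @hGR₀ @hGR₁) @χW) (EtaChi.hη (@SInstance.χVR @hGR @hGR₀ @hGR₁) @χW) (EtaChi.hηc (@SInstance.χVR @hGR @hGR₀ @hGR₁) @χW))) (thetaOf _ (thetaClassInputOf _ (fun V c => thetaSpaceInputOf hHD hI h₁ h₃ S V c)))).toCore (orientBitι L ι₁)).HypSmoothCore12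
      (((coreOf _ (_root_.HodgeCM.Model.embOf hHD hI h₁ h₃) (coverOf hHD hI h₁ h₃ hA) (wmOfInput (Wcm hGR (EtaChi.η (@SInstance.χVR @hGR @hGR₀ @hGR₁) @χW) (EtaChi.hη (@SInstance.χVR @hGR @hGR₀ @hGR₁) @χW) (EtaChi.hηc (@SInstance.χVR @hGR @hGR₀ @hGR₁) @χW))) (thetaOf _ (thetaClassInputOf _ (fun V c => thetaSpaceInputOf hHD hI h₁ h₃ S V c)))).toCore (orientBitι L ι₁)).side12 (d12Of μ)) (((coreOf _ (_root_.HodgeCM.Model.embOf hHD hI h₁ h₃) (coverOf hHD hI h₁ h₃ hA) (wmOfInput (Wcm hGR (EtaChi.η (@SInstance.χVR @hGR @hGR₀ @hGR₁) @χW) (EtaChi.hη (@SInstance.χVR @hGR @hGR₀ @hGR₁) @χW) (EtaChi.hηc (@SInstance.χVR @hGR @hGR₀ @hGR₁) @χW))) (thetaOf _ (thetaClassInputOf _ (fun V c => thetaSpaceInputOf hHD hI h₁ h₃ S V c)))).toCore (orientBitι L ι₁)).side34 (d34Of μ))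
      ((((coreOf _ (_root_.HodgeCM.Model.embOf hHD hI h₁ h₃) (coverOf hHD hI h₁ h₃ hA) (wmOfInput (Wcm hGR (EtaChi.η (@SInstance.χVR @hGR @hGR₀ @hGR₁) @χW) (EtaChi.hη (@SInstance.χVR @hGR @hGR₀ @hGR₁) @χW) (EtaChi.hηc (@SInstance.χVR @hGR @hGR₀ @hGR₁) @χW))) (thetaOf _ (thetaClassInputOf _ (fun V c => thetaSpaceInputOf hHD hI h₁ h₃ S V c)))).toCore (orientBitι L ι₁)).analyticKM (((coreOf _ (_root_.HodgeCM.Model.embOf hHD hI h₁ h₃) (coverOf hHD hI h₁ h₃ hA) (wmOfInput (Wcm hGR (EtaChi.η (@SInstance.χVR @hGR @hGR₀ @hGR₁) @χW) (EtaChi.hη (@SInstance.χVR @hGR @hGR₀ @hGR₁) @χW) (EtaChi.hηc (@SInstance.χVR @hGR @hGR₀ @hGR₁) @χW))) (thetaOf _ (thetaClassInputOf _ (fun V c => thetaSpaceInputOf hHD hI h₁ h₃ S V c)))).toCore (orientBitι L ι₁)).side12 (d12Of μ))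
        (((coreOf _ (_root_.HodgeCM.Model.embOf hHD hI h₁ h₃) (coverOf hHD hI h₁ h₃ hA) (wmOfInput (Wcm hGR (EtaChi.η (@SInstance.χVR @hGR @hGR₀ @hGR₁) @χW) (EtaChi.hη (@SInstance.χVR @hGR @hGR₀ @hGR₁) @χW) (EtaChi.hηc (@SInstance.χVR @hGR @hGR₀ @hGR₁) @χW))) (thetaOf _ (thetaClassInputOf _ (fun V c => thetaSpaceInputOf hHD hI h₁ h₃ S V c)))).toCore (orientBitι L ι₁)).side34 (d34Of μ))).toAnalytic) V c (ℓ := linOfInput (Wcm hGR (EtaChi.η (@SInstance.χVR @hGR @hGR₀ @hGR₁) @χW) (EtaChi.hη (@SInstance.χVR @hGR @hGR₀ @hGR₁) @χW) (EtaChi.hηc (@SInstance.χVR @hGR @hGR₀ @hGR₁) @χW)) V c)) := by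
  have hc' : SignRecipe.GoodCtx (orientBitι L ι₁) ι₁ c :=
    ((cpinC hHD hI h₁ h₃ hA (Wcm hGR (EtaChi.η (@SInstance.χVR @hGR @hGR₀ @hGR₁) @χW) (EtaChi.hη (@SInstance.χVR @hGR @hGR₀ @hGR₁) @χW) (EtaChi.hηc (@SInstance.χVR @hGR @hGR₀ @hGR₁) @χW)) S).thetaModel_goodCtx_iff
      (orientBitι L ι₁) (d12Of μ) (d34Of μ) ι₁ c).mp hc
  exact hyp12_of_census_of_hκAt hHD hI h₁ h₃ (orientBitι L ι₁) hA hGR (EtaChi.η (@SInstance.χVR @hGR @hGR₀ @hGR₁) @χW) (EtaChi.hη (@SInstance.χVR @hGR @hGR₀ @hGR₁) @χW) (EtaChi.hηc (@SInstance.χVR @hGR @hGR₀ @hGR₁) @χW) S μ V c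
    hc hK jD (fun hW => hκ_of_hasArchType_pairType V c.D (hGR V c) hW ((@SInstance.χVR @hGR @hGR₀ @hGR₁) V c) (χW V c) (hposW_of_goodCtx_orientBitι V hc' hcan) hcan
      (hasArchType_χVR_pairType @hGR @hGR₀ @hGR₁ V c ⟨hcan, hc'⟩ hW (hposW_of_goodCtx_orientBitι V hc' hcan))) homg

/-- **E's binder `hyp34` (row 19) AT ONE GOOD CANONICAL CONTEXT for the W family at the R1 pin's CONSTRUCTED `χV := SInstance.χVR`, modulo the (J-T) junction `homg₃₄` ONLY** ((V-val) discharged by `hasArchType_χVR_pairType`; (J-dense) by #70). -/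
theorem hyp34_of_census_R1At
    (hc : (thetaModelOf hHD hI h₁ h₃ (orientBitι L ι₁) (_root_.HodgeCM.Model.embOf hHD hI h₁ h₃) (coverOf hHD hI h₁ h₃ hA) (wmOfInput (Wcm hGR (EtaChi.η (@SInstance.χVR @hGR @hGR₀ @hGR₁) @χW) (EtaChi.hη (@SInstance.χVR @hGR @hGR₀ @hGR₁) @χW) (EtaChi.hηc (@SInstance.χVR @hGR @hGR₀ @hGR₁) @χW))) (thetaOf _ (thetaClassInputOf _ (fun V c => thetaSpaceInputOf hHD hI h₁ h₃ S V c))) (d12Of μ) (d34Of μ)).GoodCtx ι₁ c)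
    (hK : Module.finrank ℚ c.K = 6) (hcan : (InfinitePlace.mk ι₁).embedding = ι₁)
    (jD : InfinitePlace (L : Type) → EqVar → Fin 6) {σ : InfinitePlace (L : Type) → Equiv.Perm (Fin 2)}
    (homg₃₄ : ∀ (hW : (∀ j, 0 < (ι₁ ((dW c.D) j)).re) ∨ ∀ j, (ι₁ ((dW c.D) j)).re < 0) (f : FinSB ↥(maximalRealSubfield L) (Fin 6))
      (t : (printedAtσ V c.D hW jD (fun w => -μ c 2 w) (fun w => -μ c 3 w) σ).Tg)
      (φ : (printedAtσ V c.D hW jD (fun w => -μ c 2 w) (fun w => -μ c 3 w) σ).F),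
      omgW (Wcm hGR (EtaChi.η (@SInstance.χVR @hGR @hGR₀ @hGR₁) @χW) (EtaChi.hη (@SInstance.χVR @hGR @hGR₀ @hGR₁) @χW) (EtaChi.hηc (@SInstance.χVR @hGR @hGR₀ @hGR₁) @χW) V c)
          (printedTorusHom (kindOf (L : Type) (frameD V) (frameD_real V) (dW c.D) (dW_real c.D) ι₁ (datumAtσ V c.D jD (jIOf V c.D hW) σ))
            (lamOf (L : Type) (frameD V) (frameD_real V) (dW c.D) (dW_real c.D) ι₁ (datumAtσ V c.D jD (jIOf V c.D hW) σ))
            (lamOf_ne_zero (L : Type) (frameD V) (frameD_real V) (dW c.D) (dW_real c.D) ι₁ (datumAtσ V c.D jD (jIOf V c.D hW) σ))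
            (c.D.jT₃₄.toMonoidHom.comp (toAdeles (L : Type)))
            (pinnedVacs (kindOf (L : Type) (frameD V) (frameD_real V) (dW c.D) (dW_real c.D) ι₁ (datumAtσ V c.D jD (jIOf V c.D hW) σ))
              (fun w => -μ c 2 w) (fun w => -μ c 3 w)) t)
          (ins₃₄ V c.D (hGR V c) (EtaChi.η (@SInstance.χVR @hGR @hGR₀ @hGR₁) @χW V c) (datumAtσ V c.D jD (jIOf V c.D hW) σ) (fun w => -μ c 2 w) (fun w => -μ c 3 w) f φ) =
        ins₃₄ V c.D (hGR V c) (EtaChi.η (@SInstance.χVR @hGR @hGR₀ @hGR₁) @χW V c) (datumAtσ V c.D jD (jIOf V c.D hW) σ) (fun w => -μ c 2 w) (fun w => -μ c 3 w) f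
          ((printedAtσ V c.D hW jD (fun w => -μ c 2 w) (fun w => -μ c 3 w) σ).ωT t φ)) :
    Nonempty (((coreOf _ (_root_.HodgeCM.Model.embOf hHD hI h₁ h₃) (coverOf hHD hI h₁ h₃ hA) (wmOfInput (Wcm hGR (EtaChi.η (@SInstance.χVR @hGR @hGR₀ @hGR₁) @χW) (EtaChi.hη (@SInstance.χVR @hGR @hGR₀ @hGR₁) @χW) (EtaChi.hηc (@SInstance.χVR @hGR @hGR₀ @hGR₁) @χW))) (thetaOf _ (thetaClassInputOf _ (fun V c => thetaSpaceInputOf hHD hI h₁ h₃ S V c)))).toCore (orientBitι L ι₁)).HypSmoothCore34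
      (((coreOf _ (_root_.HodgeCM.Model.embOf hHD hI h₁ h₃) (coverOf hHD hI h₁ h₃ hA) (wmOfInput (Wcm hGR (EtaChi.η (@SInstance.χVR @hGR @hGR₀ @hGR₁) @χW) (EtaChi.hη (@SInstance.χVR @hGR @hGR₀ @hGR₁) @χW) (EtaChi.hηc (@SInstance.χVR @hGR @hGR₀ @hGR₁) @χW))) (thetaOf _ (thetaClassInputOf _ (fun V c => thetaSpaceInputOf hHD hI h₁ h₃ S V c)))).toCore (orientBitι L ι₁)).side12 (d12Of μ)) (((coreOf _ (_root_.HodgeCM.Model.embOf hHD hI h₁ h₃) (coverOf hHD hI h₁ h₃ hA) (wmOfInput (Wcm hGR (EtaChi.η (@SInstance.χVR @hGR @hGR₀ @hGR₁) @χW) (EtaChi.hη (@SInstance.χVR @hGR @hGR₀ @hGR₁) @χW) (EtaChi.hηc (@SInstance.χVR @hGR @hGR₀ @hGR₁) @χW))) (thetaOf _ (thetaClassInputOf _ (fun V c => thetaSpaceInputOf hHD hI h₁ h₃ S V c)))).toCore (orientBitι L ι₁)).side34 (d34Of μ))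
      ((((coreOf _ (_root_.HodgeCM.Model.embOf hHD hI h₁ h₃) (coverOf hHD hI h₁ h₃ hA) (wmOfInput (Wcm hGR (EtaChi.η (@SInstance.χVR @hGR @hGR₀ @hGR₁) @χW) (EtaChi.hη (@SInstance.χVR @hGR @hGR₀ @hGR₁) @χW) (EtaChi.hηc (@SInstance.χVR @hGR @hGR₀ @hGR₁) @χW))) (thetaOf _ (thetaClassInputOf _ (fun V c => thetaSpaceInputOf hHD hI h₁ h₃ S V c)))).toCore (orientBitι L ι₁)).analyticKM (((coreOf _ (_root_.HodgeCM.Model.embOf hHD hI h₁ h₃) (coverOf hHD hI h₁ h₃ hA) (wmOfInput (Wcm hGR (EtaChi.η (@SInstance.χVR @hGR @hGR₀ @hGR₁) @χW) (EtaChi.hη (@SInstance.χVR @hGR @hGR₀ @hGR₁) @χW) (EtaChi.hηc (@SInstance.χVR @hGR @hGR₀ @hGR₁) @χW))) (thetaOf _ (thetaClassInputOf _ (fun V c => thetaSpaceInputOf hHD hI h₁ h₃ S V c)))).toCore (orientBitι L ι₁)).side12 (d12Of μ))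
        (((coreOf _ (_root_.HodgeCM.Model.embOf hHD hI h₁ h₃) (coverOf hHD hI h₁ h₃ hA) (wmOfInput (Wcm hGR (EtaChi.η (@SInstance.χVR @hGR @hGR₀ @hGR₁) @χW) (EtaChi.hη (@SInstance.χVR @hGR @hGR₀ @hGR₁) @χW) (EtaChi.hηc (@SInstance.χVR @hGR @hGR₀ @hGR₁) @χW))) (thetaOf _ (thetaClassInputOf _ (fun V c => thetaSpaceInputOf hHD hI h₁ h₃ S V c)))).toCore (orientBitι L ι₁)).side34 (d34Of μ))).toAnalytic) V c (ℓ := linOfInput (Wcm hGR (EtaChi.η (@SInstance.χVR @hGR @hGR₀ @hGR₁) @χW) (EtaChi.hη (@SInstance.χVR @hGR @hGR₀ @hGR₁) @χW) (EtaChi.hηc (@SInstance.χVR @hGR @hGR₀ @hGR₁) @χW)) V c)) := by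
  have hc' : SignRecipe.GoodCtx (orientBitι L ι₁) ι₁ c :=
    ((cpinC hHD hI h₁ h₃ hA (Wcm hGR (EtaChi.η (@SInstance.χVR @hGR @hGR₀ @hGR₁) @χW) (EtaChi.hη (@SInstance.χVR @hGR @hGR₀ @hGR₁) @χW) (EtaChi.hηc (@SInstance.χVR @hGR @hGR₀ @hGR₁) @χW)) S).thetaModel_goodCtx_iff
      (orientBitι L ι₁) (d12Of μ) (d34Of μ) ι₁ c).mp hc
  exact hyp34_of_census_of_hκAt hHD hI h₁ h₃ (orientBitι L ι₁) hA hGR (EtaChi.η (@SInstance.χVR @hGR @hGR₀ @hGR₁) @χW) (EtaChi.hη (@SInstance.χVR @hGR @hGR₀ @hGR₁) @χW) (EtaChi.hηc (@SInstance.χVR @hGR @hGR₀ @hGR₁) @χW) S μ V c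
    hc hK jD (fun hW => hκ_of_hasArchType_pairType V c.D (hGR V c) hW ((@SInstance.χVR @hGR @hGR₀ @hGR₁) V c) (χW V c) (hposW_of_goodCtx_orientBitι V hc' hcan) hcan
      (hasArchType_χVR_pairType @hGR @hGR₀ @hGR₁ V c ⟨hcan, hc'⟩ hW (hposW_of_goodCtx_orientBitι V hc' hcan))) homg₃₄

end R1

end HodgeCM.Model.HypCensus

end
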